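import Literature.Topology.FourManifolds.CircleBandCut
import Mathlib.Analysis.Convex.Contractible
import HarnessLib

/-!
# Vanishing of the homology of the cut pieces in the ambient space

Topic `Literature/Topology/FourManifolds`; the hypotheses `hY`, `hN` of the rank count
(`CutRankCount.lean`, `KnotSquarePresentation.lean`). For a circle-valued map `f : X → S¹` and an
angle `a`, the piece `{f ≠ e^{ia}}` is mapped by `f` into the arc `S¹ ∖ {e^{ia}}`, which is an open
interval, hence contractible; so `Hₙ({f ≠ e^{ia}}) → Hₙ(X) → Hₙ(S¹)` vanishes for `n ≠ 0`
(`map_subsetIncl_comp_map_eq_zero`), and **if `f_* : H₁(X; M) → H₁(S¹; M)` is injective then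
`H₁({f ≠ e^{ia}}; M) → H₁(X; M)` is zero** (`map_subsetIncl_eq_zero_of_injective`). For a knot
complement and a map along which the meridian winds once, `f_*` is injective on
`H₁(S³ ∖ K; ℤ) ≅ ℤ` (loops missing a Seifert surface have linking number zero with the knot —
Rolfsen (1976), §5.D); that input is left to the knot files.
(The space `X` is taken in `Type`, the universe of `S¹`, so that `f_*` makes sense.)
Everything is proved; no named fact is introduced.

## References

* D. Rolfsen, *Knots and Links*, Publish or Perish (1976), §5.D, §8.C. [Rolfsen1976]
* A. Hatcher, *Algebraic Topology* (2002), §2.1 (homotopy invariance). [HatcherAT2002]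
-/

noncomputable section

open Set Function CategoryTheory Limits
open scoped Real Topology
open Literature.AlgebraicTopology.SingularHomology

namespace Literature.Topology.FourManifolds

namespace CircleMaps

/-! ### The arc `S¹ ∖ {e^{ia}}` is an open interval -/

/-- **The arc `S¹ ∖ {e^{ia}}` is homeomorphic to `(a, a + 2π)`** by the branch of the angle
(`sheetLevel` of the identity map). [folklore] -/
def arcHomeomorph (a : ℝ) : ↥{z : Circle | z ≠ Circle.exp a} ≃ₜ Ioo a (a + 2 * π) where
  toFun z := ⟨CyclicCover.sheetLevel (ContinuousMap.id Circle) a z.1,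
    CyclicCover.sheetLevel_mem_Ioo (ContinuousMap.id Circle) a z.2⟩
  invFun t := ⟨Circle.exp t, fun h => by
    obtain ⟨m, hm⟩ := Circle.exp_eq_exp.1 h
    have ht := t.2
    rcases lt_trichotomy m 0 with hm0 | rfl | hm0
    · have : (m : ℝ) ≤ -1 := by exact_mod_cast Int.le_sub_one_of_lt hm0
      nlinarith [ht.1, Real.pi_pos]
    · simp at hm; linarith [ht.1]
    · have : (1 : ℝ) ≤ m := by exact_mod_cast hm0
      nlinarith [ht.2, Real.pi_pos]⟩
  left_inv z := Subtype.ext (CyclicCover.exp_sheetLevel (ContinuousMap.id Circle) a z.1)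
  right_inv t := Subtype.ext (CyclicCover.eq_of_exp_eq_of_mem_Ioo (b := a)
    (CyclicCover.exp_sheetLevel (ContinuousMap.id Circle) a (Circle.exp t))
    (CyclicCover.sheetLevel_mem_Ioo (ContinuousMap.id Circle) a (x := Circle.exp t) (fun h => by
      obtain ⟨m, hm⟩ := Circle.exp_eq_exp.1 h
      have ht := t.2
      rcases lt_trichotomy m 0 with hm0 | rfl | hm0
      · have : (m : ℝ) ≤ -1 := by exact_mod_cast Int.le_sub_one_of_lt hm0
        nlinarith [ht.1, Real.pi_pos]
      · simp at hm; linarith [ht.1]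
      · have : (1 : ℝ) ≤ m := by exact_mod_cast hm0
        nlinarith [ht.2, Real.pi_pos])) t.2)
  continuous_toFun := (CyclicCover.continuousOn_sheetLevel (ContinuousMap.id Circle) a).comp_continuous
    continuous_subtype_val (fun z => z.2) |>.subtype_mk _
  continuous_invFun := (Circle.exp.continuous.comp continuous_subtype_val).subtype_mk _

/-- **The arc is contractible.** [folklore] -/
instance contractibleSpace_arc (a : ℝ) : ContractibleSpace ↥{z : Circle | z ≠ Circle.exp a} :=
  (arcHomeomorph a).contractibleSpace_iff.2
    ((convex_Ioo a (a + 2 * π)).contractibleSpace (nonempty_Ioo.2 (by linarith [Real.pi_pos])))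

variable {X : Type} [TopologicalSpace X] (f : C(X, Circle)) (a : ℝ)
variable (R : Type) [CommRing R] (M : Type) [AddCommGroup M] [Module R M]

/-- `f` restricted to the piece `{f ≠ e^{ia}}`, with values in the arc. [folklore] -/
def resArc : C(↥{x : X | f x ≠ Circle.exp a}, ↥{z : Circle | z ≠ Circle.exp a}) :=
  ⟨fun x => ⟨f x, x.2⟩, (f.continuous.comp continuous_subtype_val).subtype_mk _⟩

omit R M in
/-- The square: `incl ∘ resArc = f ∘ incl`. [folklore] -/
theorem subsetIncl_comp_resArc :
    (subsetIncl {z : Circle | z ≠ Circle.exp a}).comp (resArc f a) =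
      f.comp (subsetIncl {x : X | f x ≠ Circle.exp a}) := rfl

/-- **`Hₙ({f ≠ e^{ia}}) → Hₙ(X) → Hₙ(S¹)` vanishes** for `n ≠ 0` (it factors through the
contractible arc). [cite: HatcherAT2002, §2.1] -/
theorem map_subsetIncl_comp_map_eq_zero {n : ℕ} (hn : n ≠ 0) :
    singularHomology.map R M (subsetIncl {x : X | f x ≠ Circle.exp a}) n ≫ singularHomology.map R M f n = 0 := by
  rw [← singularHomology.map_comp, ← subsetIncl_comp_resArc, singularHomology.map_comp,
    show singularHomology.map R M (resArc f a) n = 0 from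
      (isZero_singularHomology_of_contractibleSpace R M (X := ↥{z : Circle | z ≠ Circle.exp a}) hn).eq_of_tgt _ _,
    zero_comp]

/-- **If `f_*` is injective on `H₁(X)`, the pieces carry no first homology of `X`**:
`H₁({f ≠ e^{ia}}; M) → H₁(X; M)` is zero. [cite: Rolfsen1976, §5.D] -/
theorem map_subsetIncl_eq_zero_of_injective (hf : Function.Injective (singularHomology.map R M f 1)) :
    singularHomology.map R M (subsetIncl {x : X | f x ≠ Circle.exp a}) 1 = 0 := by
  ext y
  apply hf
  change (singularHomology.map R M (subsetIncl {x : X | f x ≠ Circle.exp a}) 1 ≫ singularHomology.map R M f 1) y =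
    singularHomology.map R M f 1 ((0 : singularHomology R M _ 1 ⟶ singularHomology R M X 1) y)
  rw [map_subsetIncl_comp_map_eq_zero f a R M one_ne_zero]
  change (0 : singularHomology R M ↥{x : X | f x ≠ Circle.exp a} 1 →ₗ[R] singularHomology R M Circle 1) y =
    singularHomology.map R M f 1 ((0 : singularHomology R M ↥{x : X | f x ≠ Circle.exp a} 1 →ₗ[R]
      singularHomology R M X 1) y)
  rw [LinearMap.zero_apply, LinearMap.zero_apply, map_zero]

namespace CyclicCover.CircleBandData

variable {f} (B : CyclicCover.CircleBandData f)

/-- **Hypothesis `hY` of the rank count** from injectivity of `f_*`. [folklore] -/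
theorem map_subsetIncl_Y_eq_zero (hf : Function.Injective (singularHomology.map R M f 1)) :
    singularHomology.map R M (subsetIncl B.cutData.Y) 1 = 0 :=
  map_subsetIncl_eq_zero_of_injective f 0 R M hf

/-- **Hypothesis `hN` of the rank count** from injectivity of `f_*`. [folklore] -/
theorem map_subsetIncl_N_eq_zero (hf : Function.Injective (singularHomology.map R M f 1)) :
    singularHomology.map R M (subsetIncl B.cutData.N) 1 = 0 :=
  map_subsetIncl_eq_zero_of_injective f (-π) R M hf

end CyclicCover.CircleBandData

end CircleMaps

end Literature.Topology.FourManifolds
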